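import Summits.BirchSwinnertonDyer.BirchSwinnertonDyer.Theorems.SchneiderFreeSockets
import Literature.NumberTheory.EllipticCurves.IwasawaSelmerDualProofs
import HarnessLib
import HarnessLib.Audit.Tags

/-!
# Schneider-free control at an additive prime — the `t_p = 0` kernel reduction (BC3/BC5 material for
crux `AdditiveAnticycControl` and support `StepLLink` of route `SchneiderFreeAdditiveX3`)
(cell `bsd-schneider-ideate`, seat P2 «around»; memo ROUTE-P2.md v5 §9 L40–L46, Sketch v5 §1/§1b)

PROPOSED TREE FILE `Summits/BirchSwinnertonDyer/BirchSwinnertonDyer/Theorems/SchneiderFreeControlAtoms.lean`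
(after `Theorems/SchneiderFreeSockets.lean` lands). PROVED, sorry-free:
* `index_le_of_additive_links`, `two_mul_index_le_of_additive_onTreeLinks` — T-B6-1 ∧ T-B6-2(′) at one
  frame give JSW17 (eq:shalowerK-1) over `K` (the pointwise heart of support `StepLLink`);
* `additiveControlOnTreeAt_of_atoms` — **the BC5 rung of crux `AdditiveAnticycControl`**: at an additive
  `p` split in `K`, IF `E(K_𝔭)[p] = 0` (`t_p = 0`; a tree theorem at every additive `p ≥ 11` and off
  {III@5, II@7}), the pointwise control equality `SchneiderFree.AdditiveControlOnTreeAt` follows from the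
  X11b atoms (P6-add base count, P9, L10, P11) by the TREE bijection
  `AcSelmer.IsAnticyclotomic.controlMap_bijective_of_splitBad_subset` — no semistability, no (HT), no
  irreducibility;
* `localTowerTorsionFiniteAt_of_noPTorsion`, `fixedPoints_kerSubgroup_eq_bot_of_local` — Fin_v and
  `E(K_∞)[p^∞] = 0` from `E(K_𝔭)[p] = 0`.
Predicates (nothing asserted): `AdditiveControlLeOnTreeAt` (slack form), `LocalTowerTorsionFiniteAt`,
`LocalTowerTorsionFiniteClaim`, `AdditiveBaseSelmerCountAt` ((P6-add)).
-/

noncomputable section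

open scoped Classical

open WeierstrassCurve NumberField IsDedekindDomain Field Literature.NumberTheory.EllipticCurves
  Literature.NumberTheory.EllipticCurves.ModularForms
  Literature.NumberTheory.EllipticCurves.GreenbergSelmer
  Literature.NumberTheory.EllipticCurves.Rank1Residual
  Literature.NumberTheory.EllipticCurves.Rank1Residual.Typed
  Summit.BirchSwinnertonDyer.Rank1Residual
  Summit.BirchSwinnertonDyer.Rank1Residual.X11b
  Summit.BirchSwinnertonDyer.Rank1Residual.X11b.AcSelmer
  Summit.BirchSwinnertonDyer.Rank1Residual.X11b.Halves
  Summit.BirchSwinnertonDyer.BirchSwinnertonDyer.Theorems.SchneiderFree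

set_option linter.dupNamespace false

namespace Summit.BirchSwinnertonDyer.BirchSwinnertonDyer.Theorems.SchneiderFreeControlAtoms

/-! ## The slack form of control and the pointwise JSW inequality -/

section Links

variable {K : Type} [Field K] [NumberField K] {W : WeierstrassCurve ℚ} [W.IsElliptic]
  [W.IsGloballyMinimal]
variable (p : ℕ) [Fact p.Prime] (κ : ZpExtension K p) (𝔭 : HeightOneSpectrum (𝓞 K))
  (γ : Field.absoluteGaloisGroup K) [Fact (κ.IsTopGenerator γ)] (ι : K →+* ℚ_[p])

/-- **T-B6-2 (pointwise control, additive prime; NONE as printed, JSW 3.3.1 shape).** Anticyclotomic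
control for the BDP Selmer structure at an additive `p` split in `K`, as the INEQUALITY STEP L needs:
`ord_p f(0) ≥ ord_p #Ш(E/K)[p^∞] + 2·(ord_p log_{ω_E} P − ord_p [E(K):ℤP]) + ord_p ∏_{w∣N} c_w(E/K)`
is NOT what is used — the needed direction is `≤` plus the torsion slack `t` (local `p`-torsion of
`E(ℚ_p)` at an additive prime: zero for `p ≥ 11`, tree `Additive/AdditiveTorsionFiveSeven`). Typed with
an explicit slack `t`; nothing asserted. -/
@[conjecture]
def AdditiveControlLeOnTreeAt (t : ℕ) (P : (W.baseChange K).toAffine.Point) : Prop :=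
  ∃ n : ℕ, XAc.HasCharValuationAt (W.baseChange K) p κ 𝔭 ∅ γ n ∧
    (n : ℤ) ≤ (padicValNat p (Nat.card (AddCommGroup.primaryComponent (W.baseChange K).sha p)) : ℤ) +
      2 * (X11b.padicLogOrd W p ι P - (padicValNat p (AddSubgroup.zmultiples P).index : ℤ)) +
        padicValNat p (tamagawaProductSplit W K) + 2 * (t : ℤ)

variable {p κ 𝔭 γ ι} in
/-- Bookkeeping (kernel-checked): T-B6-1 ∧ T-B6-2 at the same frame give the JSW-shaped inequality
over `K` with slack `t`: `2·ord_p[E(K):ℤP] ≤ ord_p #Ш(E/K)[p^∞] + ord_p ∏_{w} c_w + 2t`. The two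
generators' valuations agree by `XAc.HasCharValuationAt.unique`. [folklore] -/
theorem index_le_of_additive_links {P : (W.baseChange K).toAffine.Point} {t : ℕ}
    (h1 : AdditiveIMCLowerBDPOnTreeAt p κ 𝔭 γ ι P) (h2 : AdditiveControlLeOnTreeAt p κ 𝔭 γ ι t P) :
    2 * (padicValNat p (AddSubgroup.zmultiples P).index : ℤ) ≤
      (padicValNat p (Nat.card (AddCommGroup.primaryComponent (W.baseChange K).sha p)) : ℤ) +
        padicValNat p (tamagawaProductSplit W K) + 2 * (t : ℤ) := by
  obtain ⟨n, hn, hle⟩ := h1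
  obtain ⟨n', hn', hle'⟩ := h2
  obtain rfl : n = n' := hn.unique hn'
  omega

end Links

/-! ## Fin_v, (P6-add), and T-B6-2′ from the X11b atoms at `t_p = 0` -/

section Atoms

variable {K : Type} [Field K] [NumberField K]

/-- **Fin_v (memo L44–L46).** Finiteness of the `p`-primary torsion of `E` over the completion of the
`ℤ_p`-extension `K_∞ = K̄^{ker κ}` at the place above `𝔭` cut out by the tree's chosen decomposition
group: `#E(K̄)[p^∞]^{D_𝔭 ⊓ ker κ} < ∞` ("`T^∨_{P_v}` finite", JSW17 §3.3 Prop. 11 Case 3(b), arXiv-text numbering). It is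
EXACTLY what Case 3(b) needs (`#ker r_v = #H⁰(K_v, W)`); JSW prove it from (sst)+(HT). A predicate;
nothing asserted. -/
@[conjecture]
def LocalTowerTorsionFiniteAt (E : WeierstrassCurve K) [E.IsElliptic] (p : ℕ) [Fact p.Prime]
    (κ : ZpExtension K p) (𝔭 : HeightOneSpectrum (𝓞 K)) : Prop :=
  (FixedPoints.addSubgroup ↥(decomp 𝔭 ⊓ κ.kerSubgroup) (E.geomPrimaryTorsion p) :
    Set (E.geomPrimaryTorsion p)).Finite

/-- Fin_v is a TREE THEOREM whenever `E(K_𝔭)[p] = 0` (the vanishing form, X11b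
`AcSelmer.fixedPoints_decomp_inf_kerSubgroup_eq_bot`: pro-`p` descent), in the stronger VANISHING
form. Over `ℚ_p` (`K_𝔭 = ℚ_p` at a split `p`) the hypothesis `E(ℚ_p)[p] = 0` is a TREE THEOREM at
every additive `p ≥ 5` off the locus {`p = 5`, `v₅(c₄) = 1` (Kodaira II/III)} ∪ {`p = 7`,
`v₇(c₆) = 1` (Kodaira II)}, and unconditionally at `p ≥ 11`
(`Additive/AdditiveTorsionFiveSeven`: `eq_zero_of_prime_nsmul_eq_zero_of_addv(_of_eleven_le)`; on
the (G)-cell the exceptions are exactly III@5 (`e = 4`) and II@7 (`e = 6`) — the same `(p, e)` at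
which the memo's tame weight shortcut for Fin_v degenerates to `e = p − 1`). [folklore] -/
theorem localTowerTorsionFiniteAt_of_noPTorsion (E : WeierstrassCurve K) [E.IsElliptic] (p : ℕ)
    [Fact p.Prime] (κ : ZpExtension K p) (𝔭 : HeightOneSpectrum (𝓞 K))
    (h0 : ∀ m : E.geomPrimaryTorsion p, (∀ d ∈ decomp 𝔭, d • m = m) → p • m = 0 → m = 0) :
    LocalTowerTorsionFiniteAt E p κ 𝔭 := by
  unfold LocalTowerTorsionFiniteAt
  rw [AcSelmer.fixedPoints_decomp_inf_kerSubgroup_eq_bot κ E 𝔭 h0]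
  exact Set.finite_singleton _ |>.subset fun x hx ↦ by simpa using hx

/-- **Global tower torsion from local (kernel-checked): `E(K_𝔭)[p] = 0 ⟹ E(K_∞)[p^∞] = 0`.**
(`ker κ ≥ D_𝔭 ⊓ ker κ`, so a `ker κ`-fixed torsion point is fixed by the smaller group, which has no
non-zero fixed points by `AcSelmer.fixedPoints_decomp_inf_kerSubgroup_eq_bot`.) Consequence used
below: at an additive `p` split in `K` with `E(ℚ_p)[p] = 0`, the restriction
`H¹(K, E[p^∞]) → H¹(K_∞, E[p^∞])` is injective with NO irreducibility hypothesis — JSW17's use of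
(irr_K) for `E(K_∞)[p^∞] = 0` (proof of Thm. 3.3.1) is discharged by the local
additive torsion theorem instead. [folklore] -/
theorem fixedPoints_kerSubgroup_eq_bot_of_local (E : WeierstrassCurve K) [E.IsElliptic] (p : ℕ)
    [Fact p.Prime] (κ : ZpExtension K p) (𝔭 : HeightOneSpectrum (𝓞 K))
    (h0 : ∀ m : E.geomPrimaryTorsion p, (∀ d ∈ decomp 𝔭, d • m = m) → p • m = 0 → m = 0) :
    FixedPoints.addSubgroup κ.kerSubgroup (E.geomPrimaryTorsion p) = ⊥ := by
  have h := AcSelmer.fixedPoints_decomp_inf_kerSubgroup_eq_bot κ E 𝔭 h0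
  rw [eq_bot_iff] at h ⊢
  intro m hm
  exact h fun g ↦ hm ⟨g.1, g.2.2⟩

variable (W : WeierstrassCurve ℚ) [W.IsElliptic] (p : ℕ) [Fact p.Prime] in
/-- **Fin_v for every `E/ℚ` at a split `p` on the anticyclotomic tower (memo L45; OUR DERIVATION by a
weight-parity argument, NOT in print as stated; JSW17 §3.3 Remark 12 flags Case 3(b) as the only use
of (HT)/(sst) in the control theorem).** Sketch: a non-zero `P_v`-invariant gives a `G_{ℚ_p}`-sub-character `β` of
`V_pE|_{G_v}` factoring through `Γ_v ⊂ Γ^{ac}`; `β` extends to a global character `κ∘Ψ` of `G_K`,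
Hodge–Tate at `v` AND (by `c`-conjugation) at `v̄` with weights `(a, −a)`, hence the `p`-adic avatar
of an algebraic Hecke character of infinity type `(a, −a)` (Tate: HT weight `0` ⟺ finite on inertia;
ray class finiteness); its Frobenius value at `v` has archimedean size `p^{−a} ∈ p^ℤ`, whereas a
sub-character of `V_pE` at a potentially good (resp. potentially multiplicative) `p` has size
`p^{a − 1/2}` (Weil) (resp. is excluded by JSW's case (ii)) — parity contradiction, no semistability,
no restriction on `(p, e)`. A predicate; nothing asserted; the memo labels it DERIVED. -/
@[conjecture]
def LocalTowerTorsionFiniteClaim : Prop :=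
  ∀ (K : Type) [Field K] [NumberField K], IsImaginaryQuadratic K → SplitsIn K p →
    ∀ (κ : ZpExtension K p), κ.IsAnticyclotomic →
      ∀ (𝔭 : HeightOneSpectrum (𝓞 K)), ((p : ℕ) : 𝓞 K) ∈ 𝔭.asIdeal →
        LocalTowerTorsionFiniteAt (W.baseChange K) p κ 𝔭

variable {W : WeierstrassCurve ℚ} [W.IsElliptic] [W.IsGloballyMinimal]
variable (p : ℕ) [Fact p.Prime] (κ : ZpExtension K p) (𝔭 : HeightOneSpectrum (𝓞 K))
  (γ : Field.absoluteGaloisGroup K) [Fact (κ.IsTopGenerator γ)] (ι : K →+* ℚ_[p])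

/-- **(P6-add) the base Selmer count at an ADDITIVE `p` split in `K` (memo L40; DERIVED, PUB
shape = JSW17 §3.2 Prop. 6 (= journal Prop. 3.2.1; Poitou–Tate: `#H¹_ac(K,W) = #Ш_BK(W/K)·(#δ_v)²`;
Remark 7: (sst), (HT) unused, (irr_K) unused for `T = T_pE`) + the additive local index).** Versus X11b's (P6) `BaseSelmerCountAt` the multiplicative `−1 = ord_p(1 − a_p p⁻¹)` is
DELETED: at an additive `p` (odd), `[E(ℚ_p) : E₁(ℚ_p)] = c_p · #Ẽ_ns(𝔽_p) = c_p · p` (Kodaira–Néron,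
`Ẽ_ns ≅ 𝔾_a`), `log_ω : E₁(ℚ_p) ⥲ pℤ_p`, so `log_ω(E(ℚ_p) ⊗ ℤ_p /tor) = p^{t_p − ord_p c_p} ℤ_p` with
`t_p = ord_p #E(ℚ_p)[p^∞]`, and `#δ_v = #ℤ_p/(log_ω P) · |c_p|_p⁻¹ / ([E(K):ℤP]_p · #H⁰(K_v,E[p^∞]))`;
read with `H⁰(K_v, E[p^∞]) = 0`: Castella-convention Selmer group over `K` has order `p^a`,
`a = ord_p #Ш(E/K)[p^∞] + 2(ord_p log_ω P − ord_p[E(K):ℤP]) + ord_p ∏_{w∣p} c_w(E/K)` (the last term is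
`0` for `p ≥ 5`: `c_p ≤ 4`). A predicate; nothing asserted. -/
@[conjecture]
def AdditiveBaseSelmerCountAt (P : (W.baseChange K).toAffine.Point) : Prop :=
  ∃ a : ℕ, (∃ _ : Finite (AcSelmer.selmerAcBase (W.baseChange K) p 𝔭 ∅),
      Nat.card (AcSelmer.selmerAcBase (W.baseChange K) p 𝔭 ∅) = p ^ a) ∧
    (a : ℤ) = (padicValNat p (Nat.card (AddCommGroup.primaryComponent (W.baseChange K).sha p)) : ℤ) +
      2 * (X11b.padicLogOrd W p ι P - (padicValNat p (AddSubgroup.zmultiples P).index : ℤ)) +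
        padicValNat p (X11b.tamagawaProductAbove W K p)


/-- T-B6-2′ in Euler-characteristic form (`#Sel^γ = p^n · #Sel_γ`), as X11b's `controlOnTreeAt_iff_card`. [folklore] -/
theorem additiveControlOnTreeAt_iff_card (P : (W.baseChange K).toAffine.Point) :
    AdditiveControlOnTreeAt p κ 𝔭 γ ι P ↔
      ∃ n : ℕ, (∃ _ : Finite (IwasawaDual.endInvariants
            (AcSelmer.conjSelmerAc (W.baseChange K) p κ 𝔭 ∅ γ - 1)),
          Nat.card (IwasawaDual.endInvariants (AcSelmer.conjSelmerAc (W.baseChange K) p κ 𝔭 ∅ γ - 1)) =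
            p ^ n * Nat.card (IwasawaDual.EndCoinvariants
              (AcSelmer.conjSelmerAc (W.baseChange K) p κ 𝔭 ∅ γ - 1))) ∧
        (n : ℤ) = (padicValNat p
            (Nat.card (AddCommGroup.primaryComponent (W.baseChange K).sha p)) : ℤ) +
          2 * (X11b.padicLogOrd W p ι P - (padicValNat p (AddSubgroup.zmultiples P).index : ℤ)) +
            padicValNat p (X11b.tamagawaProductSplit W K) := by
  haveI := X11b.module_finite_XAc_baseChange p κ 𝔭 γ (W := W)
  unfold AdditiveControlOnTreeAt
  simp only [XAc.hasCharValuationAt_iff_card]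

variable {p κ 𝔭 γ ι} in
/-- T-B6-2′ ⟹ T-B6-2 with slack `t = 0`. [folklore] -/
theorem additiveControlLeOnTreeAt_zero_of_eq {P : (W.baseChange K).toAffine.Point}
    (h : AdditiveControlOnTreeAt p κ 𝔭 γ ι P) : AdditiveControlLeOnTreeAt p κ 𝔭 γ ι 0 P := by
  obtain ⟨n, hn, he⟩ := h
  refine ⟨n, hn, ?_⟩
  simp only [Nat.cast_zero, mul_zero, add_zero]
  exact he.le

variable {p κ 𝔭 γ ι} in
/-- **Bookkeeping with `t = 0` (kernel-checked):** T-B6-1 ∧ T-B6-2′ at one frame give JSW17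
(eq:shalowerK-1) VERBATIM over `K` at an additive `p`:
`2·ord_p[E(K):ℤP] ≤ ord_p #Ш(E/K)[p^∞] + ord_p ∏_{w∣N⁺} c_w(E/K)` — no slack. [folklore] -/
theorem two_mul_index_le_of_additive_onTreeLinks {P : (W.baseChange K).toAffine.Point}
    (h1 : AdditiveIMCLowerBDPOnTreeAt p κ 𝔭 γ ι P) (h2 : AdditiveControlOnTreeAt p κ 𝔭 γ ι P) :
    2 * (padicValNat p (AddSubgroup.zmultiples P).index : ℤ) ≤
      (padicValNat p (Nat.card (AddCommGroup.primaryComponent (W.baseChange K).sha p)) : ℤ) +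
        padicValNat p (X11b.tamagawaProductSplit W K) := by
  have h := index_le_of_additive_links h1 (additiveControlLeOnTreeAt_zero_of_eq h2)
  simpa only [Nat.cast_zero, mul_zero, add_zero] using h

variable {p κ 𝔭 ι} in
/-- **T-B6-2′ FROM ATOMS (kernel-checked; memo L42).** For `K` imaginary quadratic with `p` split and
`p ∣ N_E` (additive `p`), an anticyclotomic `κ` with topological generator `γ`, ANY `𝔭`, `ι`, `P`:
IF `E(K_𝔭)[p] = 0` (`h0` — i.e. `E(ℚ_p)[p] = 0`, a tree theorem at every additive `p ≥ 11` and off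
{III@5, II@7} on the (G)-cell; it gives BOTH the strict-place vanishing (Fin_v) AND, by
`fixedPoints_kerSubgroup_eq_bot_of_local`, `E(K_∞)[p^∞] = 0`), THEN the additive base count (P6-add),
the Poitou–Tate surjectivity (P9) on `Σ(N⁺)`, the coinvariant vanishing (L10) and the local kernel
orders (P11) at `w ∈ Σ(N⁺)` give `AdditiveControlOnTreeAt`. The control-map bijection is the TREE
theorem `IsAnticyclotomic.controlMap_bijective_of_splitBad_subset` — no semistability, no (HT), no
multiplicative hypothesis, NO irreducibility: the proof of X11b's `controlOnTreeAt_of_atoms` with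
`ErratumHypotheses` (Irr ∧ Ram ∧ mult `p`) replaced by `(h0, p ∣ N)`. [folklore] -/
theorem additiveControlOnTreeAt_of_atoms (hK : IsImaginaryQuadratic K) (hsplit : SplitsIn K p)
    (hpN : p ∣ W.conductorNorm ℤ) (hκ : κ.IsAnticyclotomic)
    (γ : absoluteGaloisGroup K) [hγ : Fact (κ.IsTopGenerator γ)] (𝔭 : HeightOneSpectrum (𝓞 K))
    (ι : K →+* ℚ_[p]) (P : (W.baseChange K).toAffine.Point)
    (h0 : ∀ m : (W.baseChange K).geomPrimaryTorsion p,
      (∀ d ∈ decomp 𝔭, d • m = m) → p • m = 0 → m = 0)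
    (h6 : AdditiveBaseSelmerCountAt p 𝔭 ι P)
    (h9 : X11b.LocSurjAt (W.baseChange K) p 𝔭 (X11b.nPlusPlaces_finite (W := W) (p := p) hK.1))
    (h10 : X11b.CoinvariantsTrivialAt (W.baseChange K) p κ 𝔭 γ)
    (h11 : ∀ v ∈ X11b.nPlusPlaces W K p, X11b.LocalKernelOrderAt (W.baseChange K) p κ v) :
    AdditiveControlOnTreeAt p κ 𝔭 γ ι P := by
  have hp : p.Prime := Fact.out
  haveI : IsTotallyComplex K := hK.2
  rw [additiveControlOnTreeAt_iff_card p κ 𝔭 γ ι P]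
  obtain ⟨a, ⟨_, hcardK⟩, ha⟩ := h6
  set hfin := X11b.nPlusPlaces_finite (W := W) (p := p) (K := K) hK.1 with hfin_def
  have hSp : ∀ v ∈ X11b.nPlusPlaces W K p, ((p : ℕ) : 𝓞 K) ∉ v.asIdeal :=
    fun v hv ↦ ((X11b.mem_nPlusPlaces_iff v).mp hv).1
  have hbij : Function.Bijective
      (AcSelmer.controlMap (W.baseChange K) p κ 𝔭 (X11b.nPlusPlaces W K p) γ) :=
    AcSelmer.IsAnticyclotomic.controlMap_bijective_of_splitBad_subset (W.baseChange K) p κ 𝔭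
      (X11b.nPlusPlaces W K p) hK.1 hκ hγ.out
      (X11b.resSubgroup_kerSubgroup_injective_of_fixedPoints_eq_bot (W.baseChange K) p κ hγ.out
        (fixedPoints_kerSubgroup_eq_bot_of_local (W.baseChange K) p κ 𝔭 h0))
      (AcSelmer.fixedPoints_decomp_inf_kerSubgroup_eq_bot κ (W.baseChange K) 𝔭 h0)
      (fun v hpv hbad he1 hf1 ↦ X11b.mem_nPlusPlaces_of v hpv
        (X11b.primesEquiv_under_dvd_conductorNorm_of_not_hasGoodReductionAt K v hbad) he1 hf1)
  have hloc : AcSelmer.localKerPi (W.baseChange K) p κ hfin ≤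
      (AcSelmer.locSel (W.baseChange K) p 𝔭 hfin).range := by
    rw [AddMonoidHom.range_eq_top.mpr h9]
    exact le_top
  have hcard := AcSelmer.natCard_endInvariants_empty_eq_mul_prod (hS := hfin) hSp γ hbij hloc
  have hprod : (∏ v ∈ hfin.toFinset,
      Nat.card (AcSelmer.localKer κ.kerSubgroup ((W.baseChange K).geomPrimaryTorsion p) v)) =
      p ^ ∑ v ∈ hfin.toFinset, padicValNat p
        (((W.baseChange K).baseChange (v.adicCompletion K)).localTamagawaNumber
          (v.adicCompletionIntegers K)) := by
    rw [← Finset.prod_pow_eq_pow_sum]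
    refine Finset.prod_congr rfl fun v hv => ?_
    obtain ⟨_, hv'⟩ := h11 v (hfin.mem_toFinset.mp hv)
    exact hv'
  have hcoinv := X11b.natCard_endCoinvariants_eq_one_of_surjective _ h10
  refine ⟨a + ∑ v ∈ hfin.toFinset, padicValNat p
      (((W.baseChange K).baseChange (v.adicCompletion K)).localTamagawaNumber
        (v.adicCompletionIntegers K)), ⟨?_, ?_⟩, ?_⟩
  · refine Nat.finite_of_card_ne_zero ?_
    rw [hcard, hcardK, hprod, ← pow_add]
    exact pow_ne_zero _ hp.ne_zero
  · rw [hcard, hcardK, hprod, hcoinv, mul_one, pow_add]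
  · rw [Nat.cast_add, ha, X11b.padicValNat_tamagawaProductSplit_eq_above_add_sum W p hK.1 hsplit hpN]
    push_cast
    ring


end Atoms

end Summit.BirchSwinnertonDyer.BirchSwinnertonDyer.Theorems.SchneiderFreeControlAtoms

end
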